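import Mathlib.Analysis.SpecialFunctions.Pow.Continuity
import Literature.Analysis.Calculus.SmoothPlateau
import Literature.Analysis.Complex.StripWeakBoundaryPairing
import HarnessLib

/-!
# Weak boundary values on a strip: finitely many exceptional points are invisible

Let `u` be holomorphic on the open strip `S = {0 < im w < 1}` with
`‖u(x + iy)‖ ≤ C y^{-p} (1 - y)^{-p} e^{a|x|}`, `0 ≤ p < 1`. Say that the weak boundary values of `u` at the
bottom line are *non-negative off `B`* if for every smooth compactly supported `φ ≥ 0` with support disjoint
from `B` the pairings `∫ u(x + iy) φ(x) dx` converge, as `y → 0⁺`, to a non-negative real.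

* `weak_nonneg_erase` — non-negativity off a finite `B` implies non-negativity off `B ∖ {b}`: cut `φ` off near
  `b` with a smooth plateau of width `η` (`Literature.Analysis.Calculus.exists_smooth_plateau`, whose derivative
  has `L¹` norm `≤ 2` uniformly in `η`); the pairing with the cut-off piece is, uniformly in `0 < y ≤ h`, at
  most `A η h^{-p} + K h^{1-p}` (lift to the height `h` at the rate `norm_stripPairing_sub_lim_le` of
  `StripWeakBoundaryPairing.lean`), which is small for `h` then `η` small — the integrable blow-up `y^{-p}`
  does not see points; the limit (which exists by Hörmander's theorem, `exists_tendsto_stripPairing`) is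
  therefore within every `ε` of a non-negative real;
* `weak_nonneg_of_finset` — induction: off a finite set ⇒ for all `φ ≥ 0`;
* `weak_nonneg_reflect_top` — the same statements at the top line `im w = 1` (`y → 1⁻`) are the bottom-line
  statements for the reflected function `w ↦ conj (u (conj w + i))`.

These reduce the weak strip-rigidity theorem with exceptional sets (`StripRigidityWeak` of the line
`iic-trace-flux-pairing`, crux `ParafermionToSLESixFamilies`) to the case without exceptional points
(`Literature/Analysis/Complex/StripPositivityRigidityWeak.lean`). All statements are folklore.
-/

noncomputable section

namespace Literature.Analysis.Complex

open _root_.Complex Set Filter Metric MeasureTheory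
open scoped Topology Real ComplexConjugate

/-! ### Removing exceptional boundary points -/

/-- The integrand `x ↦ u(x + iy) ψ(x)` of a boundary pairing is integrable (`0 < y < 1`, `ψ` continuous with
compact support). [folklore] -/
theorem integrable_stripPairing_integrand {u : ℂ → ℂ}
    (hd : DifferentiableOn ℂ u {w : ℂ | 0 < w.im ∧ w.im < 1}) {ψ : ℝ → ℂ} (hψ : Continuous ψ)
    (hψc : HasCompactSupport ψ) {y : ℝ} (hy0 : 0 < y) (hy1 : y < 1) :
    Integrable fun x : ℝ => u (x + y * I) * ψ x := by
  refine Continuous.integrable_of_hasCompactSupport (Continuous.mul ?_ hψ) hψc.mul_left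
  exact hd.continuousOn.comp_continuous (by fun_prop) fun x => by simp [hy0, hy1]

/-- A non-negative complex limit: if `ℓ` is within every `ε > 0` of a non-negative real, it is one. [folklore] -/
theorem exists_nonneg_ofReal_eq {ℓ : ℂ} (h : ∀ ε > 0, ∃ L : ℝ, 0 ≤ L ∧ ‖ℓ - L‖ < ε) :
    ∃ L : ℝ, 0 ≤ L ∧ ℓ = L := by
  have him : ℓ.im = 0 := by
    by_contra hne
    obtain ⟨L, -, hL⟩ := h |ℓ.im| (abs_pos.mpr hne)
    have : |ℓ.im| ≤ ‖ℓ - L‖ := by simpa using abs_im_le_norm (ℓ - L)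
    linarith
  have hre : 0 ≤ ℓ.re := by
    by_contra hne
    push Not at hne
    obtain ⟨L, hL0, hL⟩ := h (-ℓ.re) (by linarith)
    have : |ℓ.re - L| ≤ ‖ℓ - L‖ := by simpa using abs_re_le_norm (ℓ - L)
    have : L - ℓ.re ≤ |ℓ.re - L| := by rw [abs_sub_comm]; exact le_abs_self _
    linarith
  exact ⟨ℓ.re, hre, Complex.ext (by simp) (by simp [him])⟩

/-- A small `y ∈ (0, 1/2]` with `K y^{1-p} < ε` (`p < 1`). [folklore] -/
theorem exists_small_height {K ε p : ℝ} (hε : 0 < ε) (hp : p < 1) :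
    ∃ y : ℝ, 0 < y ∧ y ≤ 1 / 2 ∧ K * y ^ (1 - p) < ε := by
  have h1 : Tendsto (fun y : ℝ => K * y ^ (1 - p)) (𝓝[>] 0) (𝓝 0) := by
    have : ContinuousAt (fun y : ℝ => y ^ (1 - p)) 0 :=
      Real.continuousAt_rpow_const 0 (1 - p) (Or.inr (by linarith))
    have h := (this.tendsto.const_mul K)
    rw [Real.zero_rpow (by linarith), mul_zero] at h
    exact tendsto_nhdsWithin_of_tendsto_nhds h
  have h2 : ∀ᶠ y : ℝ in 𝓝[>] 0, K * y ^ (1 - p) < ε := h1 (Iio_mem_nhds hε)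
  obtain ⟨y, ⟨hyK, hy⟩⟩ := (h2.and (Ioc_mem_nhdsGT (show (0:ℝ) < 1 / 2 by norm_num))).exists
  exact ⟨y, hy.1, hy.2, hyK⟩

/-- **Removing one exceptional point.** If the weak boundary values of `u` at the bottom line are
non-negative when tested against smooth compactly supported `φ ≥ 0` supported off the finite set `B`, the same
holds for `φ ≥ 0` supported off `B ∖ {b}`: cut `φ` off near `b` with a plateau of width `η`
(`Literature.Analysis.Calculus.exists_smooth_plateau`); the pairing against the cut-off part `θ_η = φ S_η(· - b)`
is, uniformly in `y ≤ h`, at most `A η h^{-p} + K h^{1-p}` (lift to height `h` at the rate of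
`norm_stripPairing_sub_lim_le`, `‖θ_η'‖₁` being bounded uniformly in `η`), which is small for `h` then `η`
small — the blow-up `y^{-p}`, `p < 1`, does not see points. [folklore] -/
theorem weak_nonneg_erase {u : ℂ → ℂ} {C a p : ℝ} (hC : 0 ≤ C) (ha : 0 ≤ a) (hp : 0 ≤ p) (hp1 : p < 1)
    (hd : DifferentiableOn ℂ u {w : ℂ | 0 < w.im ∧ w.im < 1})
    (hb : ∀ w : ℂ, 0 < w.im → w.im < 1 →
      ‖u w‖ ≤ C * w.im ^ (-p) * (1 - w.im) ^ (-p) * Real.exp (a * |w.re|))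
    (B : Finset ℝ) (b : ℝ)
    (hP : ∀ φ : ℝ → ℝ, ContDiff ℝ (⊤ : ℕ∞) φ → HasCompactSupport φ → (∀ x, 0 ≤ φ x) →
      Disjoint (tsupport φ) (↑B : Set ℝ) →
      ∃ L : ℝ, 0 ≤ L ∧ Tendsto (fun y : ℝ => ∫ x : ℝ, u (x + y * I) * (φ x : ℂ)) (𝓝[>] 0) (𝓝 (L : ℂ)))
    (φ : ℝ → ℝ) (hφ : ContDiff ℝ (⊤ : ℕ∞) φ) (hφc : HasCompactSupport φ) (hφ0 : ∀ x, 0 ≤ φ x)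
    (hdisj : Disjoint (tsupport φ) (↑(B.erase b) : Set ℝ)) :
    ∃ L : ℝ, 0 ≤ L ∧
      Tendsto (fun y : ℝ => ∫ x : ℝ, u (x + y * I) * (φ x : ℂ)) (𝓝[>] 0) (𝓝 (L : ℂ)) := by
  -- the limit exists; we show it is within every `ε` of a non-negative real
  have hφC : ContDiff ℝ (⊤ : ℕ∞) (fun x => (φ x : ℂ)) := ofRealCLM.contDiff.comp hφ
  have hφCc : HasCompactSupport (fun x => (φ x : ℂ)) := hφc.comp_left (g := ofReal) rfl
  obtain ⟨ℓ, hℓ⟩ := exists_tendsto_stripPairing hC ha hp hp1.le hd hb hφC hφCc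
  suffices key : ∀ ε > 0, ∃ L : ℝ, 0 ≤ L ∧ ‖ℓ - L‖ < ε by
    obtain ⟨L, hL, rfl⟩ := exists_nonneg_ofReal_eq key
    exact ⟨L, hL, hℓ⟩
  intro ε hε
  -- data of `φ`
  obtain ⟨R, hR⟩ : ∃ R : ℝ, tsupport φ ⊆ Icc (-R) R := by
    obtain ⟨R, hR⟩ := hφc.isCompact.isBounded.subset_closedBall 0
    exact ⟨R, fun x hx => by simpa [Real.closedBall_eq_Icc] using hR hx⟩
  obtain ⟨M₀, hM₀⟩ := hφ.continuous.bounded_above_of_compact_support hφc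
  obtain ⟨M₁, hM₁⟩ := (hφ.continuous_deriv (by simp)).bounded_above_of_compact_support hφc.deriv
  have hM₀nn : 0 ≤ M₀ := (norm_nonneg _).trans (hM₀ 0)
  have hM₁nn : 0 ≤ M₁ := (norm_nonneg _).trans (hM₁ 0)
  set E₀ : ℝ := C * 2 ^ p * Real.exp (a * R) with hE₀
  have hE₀nn : 0 ≤ E₀ := by positivity
  set Nstar : ℝ := 6 * M₁ + 2 * M₀ with hNstar
  set Kstar : ℝ := E₀ * Nstar / (1 - p) with hKstar
  have h1p : 0 < 1 - p := by linarith
  -- choose the height `h`, then the width `η`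
  obtain ⟨h, hh0, hh1, hhK⟩ := exists_small_height (K := Kstar) (show 0 < ε / 2 by positivity) hp1
  set A : ℝ := E₀ * h ^ (-p) * M₀ * 6 with hA
  have hhp : 0 ≤ h ^ (-p) := Real.rpow_nonneg hh0.le _
  have hAnn : 0 ≤ A := by positivity
  set η : ℝ := min 1 (ε / (4 * (A + 1))) with hη
  have hη0 : 0 < η := by positivity
  have hη1 : η ≤ 1 := min_le_left _ _
  have hAη : A * η ≤ ε / 4 := by
    have h1 : η ≤ ε / (4 * (A + 1)) := min_le_right _ _
    have h2 : A * (ε / (4 * (A + 1))) ≤ ε / 4 := by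
      rw [mul_div_assoc', div_le_div_iff₀ (by positivity) (by norm_num)]
      nlinarith
    exact (mul_le_mul_of_nonneg_left h1 hAnn).trans h2
  obtain ⟨S, hSs, hS0, hS1, hSone, hSzero, hS'c, hS'i, hS'L1⟩ :=
    Literature.Analysis.Calculus.exists_smooth_plateau hη0
  have hSd : Differentiable ℝ S := hSs.differentiable (by simp)
  -- the two pieces `φ = φ₁ + θ`
  set θ : ℝ → ℝ := fun x => φ x * S (x - b) with hθ
  set φ₁ : ℝ → ℝ := fun x => φ x * (1 - S (x - b)) with hφ₁
  have hθs : ContDiff ℝ (⊤ : ℕ∞) θ := hφ.mul (hSs.comp (contDiff_id.sub contDiff_const))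
  have hφ₁s : ContDiff ℝ (⊤ : ℕ∞) φ₁ :=
    hφ.mul (contDiff_const.sub (hSs.comp (contDiff_id.sub contDiff_const)))
  have hθc : HasCompactSupport θ := hφc.mul_right
  have hφ₁c : HasCompactSupport φ₁ := hφc.mul_right
  have hφ₁0 : ∀ x, 0 ≤ φ₁ x := fun x => mul_nonneg (hφ0 x) (by linarith [hS1 (x - b)])
  have hθsupp : tsupport θ ⊆ tsupport φ := tsupport_mul_subset_left
  have hφ₁supp : tsupport φ₁ ⊆ tsupport φ := tsupport_mul_subset_left
  -- `φ₁` avoids `B`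
  have hφ₁B : Disjoint (tsupport φ₁) (↑B : Set ℝ) := by
    rw [Set.disjoint_left]
    intro x hx hxB
    by_cases hxb : x = b
    · subst hxb
      rw [tsupport, mem_closure_iff_nhds] at hx
      obtain ⟨z, hz, hzs⟩ := hx (Ioo (x - η) (x + η)) (Ioo_mem_nhds (by linarith) (by linarith))
      have hzb : |z - x| ≤ η := abs_le.mpr ⟨by linarith [hz.1], by linarith [hz.2]⟩
      exact hzs (by simp [hφ₁, hSone _ hzb])
    · exact Set.disjoint_left.mp hdisj (hφ₁supp hx) (by simp [hxb, hxB])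
  obtain ⟨L, hL0, hL⟩ := hP φ₁ hφ₁s hφ₁c hφ₁0 hφ₁B
  refine ⟨L, hL0, ?_⟩
  -- the pairing with `θ` tends to `ℓ - L`
  have hθC : ContDiff ℝ (⊤ : ℕ∞) (fun x => (θ x : ℂ)) := ofRealCLM.contDiff.comp hθs
  have hθCc : HasCompactSupport (fun x => (θ x : ℂ)) := hθc.comp_left (g := ofReal) rfl
  have hφ₁Cc : HasCompactSupport (fun x => (φ₁ x : ℂ)) := hφ₁c.comp_left (g := ofReal) rfl
  have hsplit : ∀ y : ℝ, 0 < y → y < 1 → (∫ x : ℝ, u (x + y * I) * (φ x : ℂ)) =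
      (∫ x : ℝ, u (x + y * I) * (φ₁ x : ℂ)) + ∫ x : ℝ, u (x + y * I) * (θ x : ℂ) := by
    intro y hy0 hy1
    rw [← integral_add (integrable_stripPairing_integrand hd (ψ := fun x => (φ₁ x : ℂ))
      (continuous_ofReal.comp hφ₁s.continuous) hφ₁Cc hy0 hy1)
      (integrable_stripPairing_integrand hd (ψ := fun x => (θ x : ℂ))
      (continuous_ofReal.comp hθs.continuous) hθCc hy0 hy1)]
    congr 1; funext x
    simp only [hφ₁, hθ]; push_cast; ring
  have hθlim : Tendsto (fun y : ℝ => ∫ x : ℝ, u (x + y * I) * (θ x : ℂ)) (𝓝[>] 0) (𝓝 (ℓ - L)) := by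
    refine (hℓ.sub hL).congr' ?_
    filter_upwards [Ioo_mem_nhdsGT (zero_lt_one' ℝ)] with y hy
    rw [hsplit y hy.1 hy.2]; ring
  -- support and `‖θ'‖₁ ≤ Nstar`
  have hθCt : tsupport (fun x => (θ x : ℂ)) = tsupport θ := by
    simp only [tsupport]; congr 1; ext x; simp
  have hθR : tsupport (fun x => (θ x : ℂ)) ⊆ Icc (-R) R := hθCt ▸ hθsupp.trans hR
  set Iη : Set ℝ := Icc (b - 3 * η) (b + 3 * η) with hIη
  have hIη_out : ∀ x, x ∉ Iη → S (x - b) = 0 := by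
    intro x hx
    apply hSzero
    rcases not_and_or.mp hx with h1 | h1 <;> [skip; skip]
    · have : x < b - 3 * η := lt_of_not_ge h1
      rw [abs_of_neg (by linarith)]; linarith
    · have : b + 3 * η < x := lt_of_not_ge h1
      rw [abs_of_pos (by linarith)]; linarith
  have hIvol : volume.real Iη = 6 * η := by
    rw [hIη, Real.volume_real_Icc_of_le (by linarith)]; ring
  have hIint : ∀ c : ℝ, Integrable (Iη.indicator fun _ : ℝ => c) := fun c =>
    (integrable_indicator_iff measurableSet_Icc).mpr (integrableOn_const (by simp [Real.volume_Icc]))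
  have hderivθ : ∀ x, deriv (fun x => (θ x : ℂ)) x = ((deriv φ x * S (x - b) + φ x * deriv S (x - b) : ℝ) : ℂ) := by
    intro x
    have h1 : HasDerivAt θ (deriv φ x * S (x - b) + φ x * deriv S (x - b)) x :=
      (hφ.differentiable (by simp)).differentiableAt.hasDerivAt.mul
        (HasDerivAt.comp_sub_const x b (hSd (x - b)).hasDerivAt)
    exact h1.ofReal_comp.deriv
  have hNθ : (∫ x : ℝ, ‖deriv (fun x => (θ x : ℂ)) x‖) ≤ Nstar := by
    have hpt : ∀ x, ‖deriv (fun x => (θ x : ℂ)) x‖ ≤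
        Iη.indicator (fun _ => M₁) x + M₀ * |deriv S (x - b)| := by
      intro x
      rw [hderivθ x, Complex.norm_real, Real.norm_eq_abs]
      have h2 : |φ x * deriv S (x - b)| ≤ M₀ * |deriv S (x - b)| := by
        rw [abs_mul]; exact mul_le_mul_of_nonneg_right (by simpa using hM₀ x) (abs_nonneg _)
      have h1 : |deriv φ x * S (x - b)| ≤ Iη.indicator (fun _ => M₁) x := by
        by_cases hx : x ∈ Iη
        · rw [indicator_of_mem hx, abs_mul, abs_of_nonneg (hS0 _)]
          calc |deriv φ x| * S (x - b) ≤ M₁ * 1 :=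
                mul_le_mul (by simpa using hM₁ x) (hS1 _) (hS0 _) hM₁nn
            _ = M₁ := mul_one _
        · rw [indicator_of_notMem hx, hIη_out x hx]; simp
      exact (abs_add_le _ _).trans (add_le_add h1 h2)
    have hint1 : Integrable fun x => M₀ * |deriv S (x - b)| := ((hS'i.comp_sub_right b).abs).const_mul M₀
    calc (∫ x : ℝ, ‖deriv (fun x => (θ x : ℂ)) x‖)
        ≤ ∫ x : ℝ, (Iη.indicator (fun _ => M₁) x + M₀ * |deriv S (x - b)|) := by
          refine integral_mono_of_nonneg (Filter.Eventually.of_forall fun x => norm_nonneg _)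
            ((hIint M₁).add hint1) (Filter.Eventually.of_forall hpt)
      _ = 6 * η * M₁ + M₀ * ∫ x : ℝ, |deriv S x| := by
          rw [integral_add (hIint M₁) hint1, integral_indicator_const _ measurableSet_Icc, hIvol,
            integral_const_mul, smul_eq_mul]
          congr 2
          exact integral_sub_right_eq_self (μ := volume) (fun x => |deriv S x|) b
      _ ≤ 6 * 1 * M₁ + M₀ * 2 := by gcongr
      _ = Nstar := by rw [hNstar]; ring
  -- the pairing with `θ` at height `h` is small
  have hθh : ‖∫ x : ℝ, u (x + h * I) * (θ x : ℂ)‖ ≤ A * η := by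
    have hpt : ∀ x : ℝ, ‖u (x + h * I) * (θ x : ℂ)‖ ≤ Iη.indicator (fun _ => E₀ * h ^ (-p) * M₀) x := by
      intro x
      by_cases hθx : θ x = 0
      · rw [hθx]
        simp only [ofReal_zero, mul_zero, norm_zero]
        by_cases hx : x ∈ Iη
        · rw [indicator_of_mem hx]; positivity
        · rw [indicator_of_notMem hx]
      · have hxφ : x ∈ tsupport φ := hθsupp (subset_tsupport _ hθx)
        have hxR : |x| ≤ R := abs_le.mpr (by simpa using hR hxφ)
        have hxI : x ∈ Iη := by
          by_contra hx; exact hθx (by simp [hθ, hIη_out x hx])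
        rw [indicator_of_mem hxI, norm_mul, Complex.norm_real, Real.norm_eq_abs]
        have hu := norm_le_of_strip_growth_lower (w := (x : ℂ) + h * I) hC ha hp hb (by simpa using hh0)
          (by simpa using hh1) (by simpa using hxR)
        have hθb : |θ x| ≤ M₀ := by
          simp only [hθ, abs_mul, abs_of_nonneg (hS0 _)]
          calc |φ x| * S (x - b) ≤ M₀ * 1 := mul_le_mul (by simpa using hM₀ x) (hS1 _) (hS0 _) hM₀nn
            _ = M₀ := mul_one _
        have him : ((x : ℂ) + h * I).im = h := by simp
        rw [him] at hu
        calc ‖u (x + h * I)‖ * |θ x| ≤ E₀ * h ^ (-p) * M₀ :=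
              mul_le_mul hu hθb (abs_nonneg _) (by positivity)
          _ = E₀ * h ^ (-p) * M₀ := rfl
    calc ‖∫ x : ℝ, u (x + h * I) * (θ x : ℂ)‖
        ≤ ∫ x : ℝ, Iη.indicator (fun _ => E₀ * h ^ (-p) * M₀) x :=
          norm_integral_le_of_norm_le (hIint _) (Filter.Eventually.of_forall hpt)
      _ = A * η := by
          rw [integral_indicator_const _ measurableSet_Icc, hIvol, smul_eq_mul, hA]; ring
  -- conclusion
  have hrate := norm_stripPairing_sub_lim_le hC ha hp hp1 hd hb hθC hθR hNθ hθlim hh0 hh1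
  have hKh : C * 2 ^ p * Real.exp (a * R) * Nstar / (1 - p) * h ^ (1 - p) < ε / 2 := by
    simpa only [hKstar, hE₀] using hhK
  calc ‖ℓ - L‖ = ‖-((∫ x : ℝ, u (x + h * I) * (θ x : ℂ)) - (ℓ - L)) + ∫ x : ℝ, u (x + h * I) * (θ x : ℂ)‖ := by
        congr 1; ring
    _ ≤ ‖(∫ x : ℝ, u (x + h * I) * (θ x : ℂ)) - (ℓ - L)‖ + ‖∫ x : ℝ, u (x + h * I) * (θ x : ℂ)‖ := by
        rw [← norm_neg ((∫ x : ℝ, u (x + h * I) * (θ x : ℂ)) - (ℓ - L))]; exact norm_add_le _ _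
    _ < ε / 2 + ε / 4 := by
        refine add_lt_add_of_lt_of_le (lt_of_le_of_lt hrate hKh) (hθh.trans hAη)
    _ < ε := by linarith

/-- **Finitely many exceptional boundary points are invisible.** If the weak boundary values of `u` at the
bottom line are non-negative off a finite set `B₀`, they are non-negative (and exist) for every smooth
compactly supported `φ ≥ 0` (induction on `B₀` with `weak_nonneg_erase`). [folklore] -/
theorem weak_nonneg_of_finset {u : ℂ → ℂ} {C a p : ℝ} (hC : 0 ≤ C) (ha : 0 ≤ a) (hp : 0 ≤ p) (hp1 : p < 1)
    (hd : DifferentiableOn ℂ u {w : ℂ | 0 < w.im ∧ w.im < 1})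
    (hb : ∀ w : ℂ, 0 < w.im → w.im < 1 →
      ‖u w‖ ≤ C * w.im ^ (-p) * (1 - w.im) ^ (-p) * Real.exp (a * |w.re|))
    (B₀ : Finset ℝ)
    (hP : ∀ φ : ℝ → ℝ, ContDiff ℝ (⊤ : ℕ∞) φ → HasCompactSupport φ → (∀ x, 0 ≤ φ x) →
      Disjoint (tsupport φ) (↑B₀ : Set ℝ) →
      ∃ L : ℝ, 0 ≤ L ∧ Tendsto (fun y : ℝ => ∫ x : ℝ, u (x + y * I) * (φ x : ℂ)) (𝓝[>] 0) (𝓝 (L : ℂ)))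
    (φ : ℝ → ℝ) (hφ : ContDiff ℝ (⊤ : ℕ∞) φ) (hφc : HasCompactSupport φ) (hφ0 : ∀ x, 0 ≤ φ x) :
    ∃ L : ℝ, 0 ≤ L ∧
      Tendsto (fun y : ℝ => ∫ x : ℝ, u (x + y * I) * (φ x : ℂ)) (𝓝[>] 0) (𝓝 (L : ℂ)) := by
  induction B₀ using Finset.induction_on generalizing φ with
  | empty => exact hP φ hφ hφc hφ0 (by simp)
  | @insert b s hbs ih =>
    refine ih (fun ψ hψ hψc hψ0 hdisj => ?_) φ hφ hφc hφ0
    have := weak_nonneg_erase hC ha hp hp1 hd hb (insert b s) b hP ψ hψ hψc hψ0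
      (by rwa [Finset.erase_insert hbs])
    exact this

/-- **The top line, reflected to the bottom.** Weak non-negativity of `u` at the top line `im w = 1`
(limits as `y → 1⁻`) is weak non-negativity at the bottom line of the reflected function
`w ↦ conj (u (conj w + i))` (which is again holomorphic on the strip with the same growth). [folklore] -/
theorem weak_nonneg_reflect_top {u : ℂ → ℂ} (T : Set ℝ)
    (hP : ∀ φ : ℝ → ℝ, ContDiff ℝ (⊤ : ℕ∞) φ → HasCompactSupport φ → (∀ x, 0 ≤ φ x) →
      Disjoint (tsupport φ) T →
      ∃ L : ℝ, 0 ≤ L ∧ Tendsto (fun y : ℝ => ∫ x : ℝ, u (x + y * I) * (φ x : ℂ)) (𝓝[<] 1) (𝓝 (L : ℂ)))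
    (φ : ℝ → ℝ) (hφ : ContDiff ℝ (⊤ : ℕ∞) φ) (hφc : HasCompactSupport φ) (hφ0 : ∀ x, 0 ≤ φ x)
    (hdisj : Disjoint (tsupport φ) T) :
    ∃ L : ℝ, 0 ≤ L ∧ Tendsto (fun y : ℝ => ∫ x : ℝ,
      (conj (u (conj ((x : ℂ) + y * I) + I))) * (φ x : ℂ)) (𝓝[>] 0) (𝓝 (L : ℂ)) := by
  obtain ⟨L, hL0, hL⟩ := hP φ hφ hφc hφ0 hdisj
  refine ⟨L, hL0, ?_⟩
  have e : ∀ y : ℝ, (∫ x : ℝ, conj (u (conj ((x : ℂ) + y * I) + I)) * (φ x : ℂ)) =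
      conj (∫ x : ℝ, u (x + ((1 - y : ℝ) : ℂ) * I) * (φ x : ℂ)) := by
    intro y
    rw [← integral_conj]
    congr 1; funext x
    have hpt : conj ((x : ℂ) + y * I) + I = (x : ℂ) + ((1 - y : ℝ) : ℂ) * I := by
      apply Complex.ext <;> simp; ring
    rw [map_mul, conj_ofReal, hpt]
  simp_rw [e]
  have h1 : Tendsto (fun y : ℝ => 1 - y) (𝓝[>] (0:ℝ)) (𝓝[<] (1:ℝ)) := by
    refine tendsto_nhdsWithin_of_tendsto_nhds_of_eventually_within _ ?_ ?_
    · have : Tendsto (fun y : ℝ => 1 - y) (𝓝 0) (𝓝 (1 - 0)) := tendsto_const_nhds.sub tendsto_id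
      rw [sub_zero] at this
      exact this.mono_left nhdsWithin_le_nhds
    · filter_upwards [self_mem_nhdsWithin] with y hy
      simp only [mem_Iio, mem_Ioi] at hy ⊢; linarith
  have h3 := ((continuous_conj.tendsto (L : ℂ)).comp (hL.comp h1))
  rw [conj_ofReal] at h3
  exact h3

end Literature.Analysis.Complex
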